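import Summits.QuantumFields.YangMills.Theorems.FluctuationComparisonRegPrIntLS2BetaSignedCombCount
import HarnessLib

/-!
# LINE g18-1 S2β LAPLACE — (FP-GAP) THE ROOTED POINCARÉ INEQUALITY ON THE BLOCK COMB
# (the kinematic coercivity of the Faddeev–Popov form `D^*D` of the residual gauge group; LOCATE-DECAY (OPL))

Crux `stmt-QuantumFields-20520` (`…Theses.UnitScaleTilt.FluctuationComparisonRegPrIntL`); cell `ym3-torus` (HUMAN RULING D-0037 — YM₃ on T³ is
ladder rung R3, not the Clay problem), width seat `ym3-torus-px21` g11; count-neutral helper (`--kind proof --supports stmt-QuantumFields-20520 --as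
helper`).  Theorems only: 0 `def`, 0 `instance`, 0 `notation`, 0 `sorry`.

WHY.  w4-20520 g15's LOCATE-DECAY memo (FOUR-POINT-DECAY, the one displayed residue of LAPLACE in `Lines/semiclassical_s2beta.lean` v9) reads the
intrinsic semiclassical constant as `log ℓ_x = c₀ + log jac + log det(D_x^* D_x) − ½ log det(H + D_x D_x^*)` (CLF), where `D_x` is the differential at `1`
of `k ↦ pivotAct k U₀ˣ` on `Lie(residualSubgroup) × 𝔰𝔲(2)^{pivots}`; its row (OPL) asks for the COERCIVITY of the Faddeev–Popov form `D^*D`, «the rooted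
Poincaré inequality on the `(K−J)`-block complex (px21's comb machinery is the natural supplier)».  Near `1` the residual group IS print's rooted sheet
(`w = 1` at the `k`-centres, ✓`…S2BetaLaplaceInstGroupChart.groupChart_rows_of_rooted`), so `Lie(residualSubgroup)` = the site fields `λ` VANISHING AT
THE `k`-CENTRES, and off the pivots `D(λ, ξ)(b) = λ(b₋) − Ad(U₀ b) λ(b₊)` (right-trivialised), `D(λ, ξ)(βₖ c) = ξ_c` on the pivots.

WHAT (all kinematic: no field equation, no smallness, every `U₀`; standing range `k ≤ m + K`).
* §1 DEPTH BOOKKEEPING on the signed comb of ✓`…S2BetaSignedCombCount` (`toBond` ∕ `far` ∕ `lastDir`): every non-central site `x` has a NEAR END `x′`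
  one signed step closer to its centre along a comb bond (`exists_nearEnd`), the signed depth `Σ_μ |x_μ − (root x)_μ|` drops by one and is `≤ d·Lᵏ`;
  the `k`-block of a centre has `(Lᵈ)ᵏ` fine sites (`card_filter_blockIter_eq`, `card_filter_rootOf_eq`).
* §2 ★★ `sum_sq_le_comb` — THE SCALAR COMB POINCARÉ INEQUALITY: for `ν : sites → ℝ` vanishing at the `k`-centres and `δ : bonds → ℝ` with
  `|ν(b₋) − ν(b₊)| ≤ δ(b)` on the comb bonds, `Σ_x ν(x)² ≤ (d·Lᵏ)²·(Lᵈ)ᵏ · Σ_{b ∈ combSet k} δ(b)²` (induction on the depth: `|ν x| ≤ depth(x)·M(x)` with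
  `M(x)² = Σ_{comb bonds of the block of x} δ²`, then the block count).
* §3 ★★ `sum_norm_sq_le_comb_of_rooted` — THE LINEAR COVARIANT FORM = the FP coercivity of (OPL): `E` any seminormed group, `T b : E → E` norm
  preserving (consumer: `T b := Ad(U₀ b)` on `𝔰𝔲(2)` in any `Ad`-invariant norm), `λ` rooted ⇒ `Σ_x ‖λ x‖² ≤ C · Σ_{b ∈ comb} ‖λ(b₋) − T_b λ(b₊)‖²`; a fortiori
  with the sum over the OFF-PIVOT bonds (`sum_norm_sq_le_offPivot_of_rooted`, token shape of (T2)'s off-pivot filter; comb ⊆ off-pivot by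
  ✓`iterCentralBond_not_mem_combSet`) or over all bonds (`sum_norm_sq_le_of_rooted`).
* §4 ★ `sum_dist1_sq_le_comb_of_rootTrivial` — THE GROUP FORM, the quantitative edition of px21 g9's off-pivot freeness
  ✓`eq_one_of_isResidual_of_gaugeAct_eq_on_combSet`: a rooted `w` (any `GaugeGroup G`, any `U`) satisfies
  `Σ_x dist1(w x)² ≤ C · Σ_{b ∈ comb} dist1((w • U) b · (U b)⁻¹)²`.
SCALING (honest): `C = d²·L^{(d+2)k}` is crude; but no rooted-POINT Poincaré constant is `O(L^{2k})`: the test function `1 − 𝟙_{centres}` shows the best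
constant for the FULL bond sum is `≥ (L^{dk} − 1)∕(2d)`, so in `d = 3` the point-rooted FP gap is `≲ L^{−3(K−J)}` in fine units — the depth-uniformity of
`fourPt log det(D^*D)` is the organ's business (a `U₀`-independent Gram factor of `Lie(K)` cancels in a 4-point difference), not this file's.
HONEST: lattice bookkeeping (a Poincaré inequality on a rooted spanning forest); proves no stub; (OPL)∕(BRD)∕FOUR-POINT-DECAY∕LAPLACE∕S2β∕crux 20520 NOT
proved; rung R3 = YM₃ on T³ — NOT d = 4, NOT infinite volume, NOT a mass gap, NOT Clay; the Yang–Mills mass gap is NOT proved.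
[cite: Balaban1985Variational, Thm 1 (8)-(10) p.279, (19) p.281, (142) p.299, (181) p.307; Balaban1987RG1, (0.1)-(0.4) pp.251-253, (0.21) p.256;
Balaban1985Averaging, (8) p.19]
-/

open Finset
open Literature.MathematicalPhysics.QuantumFieldTheory.Balaban1983to89
open Literature.MathematicalPhysics.QuantumFieldTheory.Balaban1983to89.T4RootedResidualGauge (rootOf rootOf_embIter blockIter_rootOf)
open Literature.MathematicalPhysics.QuantumFieldTheory.Balaban1983to89.B15DeterminingSets (embIter)
open Literature.MathematicalPhysics.QuantumFieldTheory.Balaban1983to89.B14.Eq22Determines (blockIter blockIter_zero blockIter_succ)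
open Literature.MathematicalPhysics.QuantumFieldTheory.Balaban1983to89.B15Eq177GaugeInvariance (blockIter_embIter)
open Literature.MathematicalPhysics.QuantumFieldTheory.Balaban1983to89.GaugeField (gaugeAct)
open Literature.MathematicalPhysics.QuantumFieldTheory.Balaban1983to89.B10StarCount (shift_unshift unshift_shift)
open Summit.QuantumFields.YangMills.Theorems.FluctuationComparisonRegPrIntLWregChain (iterCentralBond)
open Summit.QuantumFields.YangMills.Theorems.FluctuationComparisonRegPrIntLS2BetaSignedCombKill
open Summit.QuantumFields.YangMills.Theorems.FluctuationComparisonRegPrIntLS2BetaSignedCombCount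

namespace Summit.QuantumFields.YangMills.Theorems.FluctuationComparisonRegPrIntLS2BetaCombPoincare

variable {P : Params} {k : ℕ}

/-! ## §1  Depth bookkeeping on the signed comb -/

/-- A CENTRE IS A FIXED POINT OF `root`: `root x = x` iff `x = ιᵏ(Bᵏ x)`; in particular a function vanishing at the `k`-centres vanishes at every
root. [cite: Balaban1987RG1, (0.1) p.251 (bookkeeping)] -/
theorem eq_embIter_blockIter_of_rootOf_eq {x : Site P 0} (hx : rootOf k x = x) : x = embIter k (blockIter k x) := hx.symm

/-- ★ THE NEAR END OF A NON-CENTRAL SITE: one signed step back along the last comb bond of `x` (✓`toBond`) lands at a site `x′` of the same block whose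
signed depth `Σ_μ |x′_μ − (root x′)_μ|` is one less; the bond joining them is a comb bond, oriented either way.
[cite: Balaban1985Variational, (19) p.281; Balaban1987RG1, (0.1) p.251 (bookkeeping)] -/
theorem exists_nearEnd (hk : k ≤ P.m + P.K) {x : Site P 0} (hx : rootOf k x ≠ x) :
    ∃ (b : PBond P 0) (x' : Site P 0), b ∈ (combSet k : Set (PBond P 0)) ∧ rootOf k x' = rootOf k x ∧
      ((b.src = x' ∧ b.tgt = x) ∨ (b.src = x ∧ b.tgt = x')) ∧
      (∑ μ : Fin P.d, (((x' μ).val : ℤ) - ((rootOf k x' μ).val : ℤ)).natAbs) + 1 =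
        ∑ μ : Fin P.d, (((x μ).val : ℤ) - ((rootOf k x μ).val : ℤ)).natAbs := by
  obtain ⟨h1, _⟩ := lastDir_spec hx
  set μ := lastDir k x hx with hμ
  have hsplit : ∀ f : Fin P.d → ℕ, ∑ ν, f ν = f μ + ∑ ν ∈ univ.erase μ, f ν :=
    fun f => (add_sum_erase _ _ (mem_univ μ)).symm
  by_cases hlt : (rootOf k x μ).val < (x μ).val
  · -- one step back above the centre: `b = ⟨x − e_μ, μ⟩`, near end `x − e_μ`
    obtain ⟨hv, hblk⟩ := unshift_of_lt hk hlt
    have hroot : rootOf k (x.unshift μ) = rootOf k x := rootOf_eq_of_blockIter_eq hblk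
    refine ⟨toBond k x hx, x.unshift μ, toBond_mem hk hx, hroot, Or.inl ⟨?_, ?_⟩, ?_⟩
    · rw [toBond_eq hx rfl, if_pos hlt]
    · rw [toBond_eq hx rfl, if_pos hlt]
      exact shift_unshift x μ
    · rw [hsplit, hsplit (fun ν => (((x ν).val : ℤ) - ((rootOf k x ν).val : ℤ)).natAbs), hroot]
      have hrest : ∑ ν ∈ univ.erase μ, ((((x.unshift μ) ν).val : ℤ) - ((rootOf k x ν).val : ℤ)).natAbs =
          ∑ ν ∈ univ.erase μ, (((x ν).val : ℤ) - ((rootOf k x ν).val : ℤ)).natAbs := by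
        refine sum_congr rfl fun ν hν => ?_
        have hne : ν ≠ μ := (mem_erase.1 hν).1
        simp only [Site.unshift, Function.update_of_ne hne]
      rw [hrest, hv]
      have h0 : 1 ≤ (x μ).val := by omega
      push_cast [Nat.cast_sub h0]
      omega
  · -- the bond at `x`, below the centre: `b = ⟨x, μ⟩`, near end `x + e_μ`
    have hlt' : (x μ).val < (rootOf k x μ).val :=
      lt_of_le_of_ne (not_lt.1 hlt) fun hE => h1 (ZMod.val_injective _ hE)
    obtain ⟨hv, hblk⟩ := shift_of_lt hk hlt'
    have hroot : rootOf k (x.shift μ) = rootOf k x := rootOf_eq_of_blockIter_eq hblk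
    refine ⟨toBond k x hx, x.shift μ, toBond_mem hk hx, hroot, Or.inr ⟨?_, ?_⟩, ?_⟩
    · rw [toBond_eq hx rfl, if_neg hlt]
    · rw [toBond_eq hx rfl, if_neg hlt]; rfl
    · rw [hsplit, hsplit (fun ν => (((x ν).val : ℤ) - ((rootOf k x ν).val : ℤ)).natAbs), hroot]
      have hrest : ∑ ν ∈ univ.erase μ, ((((x.shift μ) ν).val : ℤ) - ((rootOf k x ν).val : ℤ)).natAbs =
          ∑ ν ∈ univ.erase μ, (((x ν).val : ℤ) - ((rootOf k x ν).val : ℤ)).natAbs := by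
        refine sum_congr rfl fun ν hν => ?_
        have hne : ν ≠ μ := (mem_erase.1 hν).1
        simp only [Site.shift, Function.update_of_ne hne]
      rw [hrest, hv]
      push_cast
      omega

/-- THE SIGNED DEPTH IS AT MOST `d·Lᵏ` (each signed offset is `≤ (Lᵏ−1)∕2`, ✓`val_rootOf_le`). [cite: Balaban1987RG1, (0.1) pp.251-252 (bookkeeping)] -/
theorem depth_le (hk : k ≤ P.m + P.K) (x : Site P 0) :
    ∑ μ : Fin P.d, (((x μ).val : ℤ) - ((rootOf k x μ).val : ℤ)).natAbs ≤ P.d * P.L ^ k := by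
  have hb : ∀ μ ∈ (univ : Finset (Fin P.d)), (((x μ).val : ℤ) - ((rootOf k x μ).val : ℤ)).natAbs ≤ P.L ^ k := by
    intro μ _
    obtain ⟨h₁, h₂⟩ := val_rootOf_le hk x μ
    have h3 : (P.L ^ k - 1) / 2 ≤ P.L ^ k := by omega
    omega
  have := sum_le_card_nsmul _ _ _ hb
  simpa only [card_univ, Fintype.card_fin, smul_eq_mul] using this

/-- THE `k`-BLOCK OF A COARSE SITE HAS `(Lᵈ)ᵏ` FINE SITES: `#{x ∈ T_η | Bᵏ x = y} = L^{dk}` (print: «`Bᵏ(y)` … the `L^{kd}` points of the finer lattice»).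
[cite: Balaban1987RG1, (0.3) p.252] -/
theorem card_filter_blockIter_eq : ∀ {k : ℕ}, k ≤ P.m + P.K → ∀ y : Site P k,
    (univ.filter fun x : Site P 0 => blockIter k x = y).card = (P.L ^ P.d) ^ k
  | 0, _, y => by
      simp only [blockIter_zero, pow_zero]
      rw [filter_eq' univ y, if_pos (mem_univ y), card_singleton]
  | k + 1, hk, y => by
      have hfib : ∀ x ∈ univ.filter (fun x : Site P 0 => blockIter (k + 1) x = y), blockIter k x ∈ block y := by
        intro x hx
        rw [mem_filter] at hx
        exact mem_filter.2 ⟨mem_univ _, by simpa only [blockIter_succ] using hx.2⟩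
      rw [card_eq_sum_card_fiberwise hfib]
      have hterm : ∀ z ∈ block y, ((univ.filter fun x : Site P 0 => blockIter (k + 1) x = y).filter
          (fun x => blockIter k x = z)).card = (P.L ^ P.d) ^ k := by
        intro z hz
        have hz' : blockOf z = y := (mem_filter.1 hz).2
        rw [← card_filter_blockIter_eq (k := k) (by omega) z]
        congr 1
        ext x
        simp only [mem_filter, mem_univ, true_and, blockIter_succ]
        exact ⟨fun h => h.2, fun h => ⟨by rw [h, hz'], h⟩⟩
      rw [sum_congr rfl hterm, sum_const, Site.card_block (by omega), smul_eq_mul, pow_succ, mul_comm]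

/-- SAME ROOT = SAME `k`-BLOCK, counted: `#{x | root x₀ = root x} = (Lᵈ)ᵏ`. [cite: Balaban1987RG1, (0.3) p.252 (bookkeeping)] -/
theorem card_filter_rootOf_eq (hk : k ≤ P.m + P.K) (x₀ : Site P 0) :
    (univ.filter fun x : Site P 0 => rootOf k x₀ = rootOf k x).card = (P.L ^ P.d) ^ k := by
  rw [← card_filter_blockIter_eq hk (blockIter k x₀)]
  congr 1
  ext x
  simp only [mem_filter, mem_univ, true_and]
  constructor
  · intro h
    have := congrArg (blockIter k) h
    rwa [blockIter_rootOf hk, blockIter_rootOf hk, eq_comm] at this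
  · intro h
    exact (rootOf_eq_of_blockIter_eq h).symm

/-! ## §2  The scalar comb Poincaré inequality -/

/-- ★★ **THE SCALAR COMB POINCARÉ INEQUALITY** (rooted at the `k`-centres): if `ν : T_η → ℝ` vanishes at the `k`-centres and changes by at most `δ(b)`
across every comb bond `b` (`|ν(b₋) − ν(b₊)| ≤ δ(b)` on `combSet k`), then
`Σ_x ν(x)² ≤ (d·Lᵏ)²·(Lᵈ)ᵏ · Σ_{b ∈ combSet k} δ(b)²`.
Proof: along the comb path `|ν x| ≤ depth(x) · M(x)` with `M(x)² = Σ_{comb bonds of the block of x} δ²` (induction on the signed depth via `exists_nearEnd`),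
`depth ≤ d·Lᵏ` (`depth_le`), and each comb bond is counted once per site of its block (`card_filter_rootOf_eq`).
[cite: Balaban1985Variational, (19) p.281, (142) p.299; Balaban1987RG1, (0.1)-(0.3) pp.251-252] -/
theorem sum_sq_le_comb (hk : k ≤ P.m + P.K) [DecidablePred (· ∈ (combSet k : Set (PBond P 0)))]
    (ν : Site P 0 → ℝ) (δ : PBond P 0 → ℝ) (hν0 : ∀ y : Site P k, ν (embIter k y) = 0)
    (hδ : ∀ b ∈ (combSet k : Set (PBond P 0)), |ν b.src - ν b.tgt| ≤ δ b) :
    ∑ x, ν x ^ 2 ≤ (((P.d * P.L ^ k) ^ 2 * (P.L ^ P.d) ^ k : ℕ) : ℝ) *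
      ∑ b ∈ univ.filter (fun b => b ∈ (combSet k : Set (PBond P 0))), δ b ^ 2 := by
  set CF : Finset (PBond P 0) := univ.filter (fun b => b ∈ (combSet k : Set (PBond P 0))) with hCF
  -- the block energy
  set M : Site P 0 → ℝ := fun x => Real.sqrt (∑ b ∈ CF.filter (fun b => rootOf k b.src = rootOf k x), δ b ^ 2) with hM
  have hM0 : ∀ x, 0 ≤ M x := fun x => Real.sqrt_nonneg _
  have hMsq : ∀ x, M x ^ 2 = ∑ b ∈ CF.filter (fun b => rootOf k b.src = rootOf k x), δ b ^ 2 :=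
    fun x => Real.sq_sqrt (sum_nonneg fun b _ => sq_nonneg _)
  have hMroot : ∀ {x x' : Site P 0}, rootOf k x' = rootOf k x → M x' = M x := by
    intro x x' h
    simp only [hM, h]
  have hMge : ∀ (x : Site P 0) (b : PBond P 0), b ∈ (combSet k : Set (PBond P 0)) → rootOf k b.src = rootOf k x → δ b ≤ M x := by
    intro x b hb hbx
    have hδ0 : 0 ≤ δ b := (abs_nonneg _).trans (hδ b hb)
    have hmem : b ∈ CF.filter (fun b => rootOf k b.src = rootOf k x) :=
      mem_filter.2 ⟨mem_filter.2 ⟨mem_univ _, hb⟩, hbx⟩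
    calc δ b = Real.sqrt (δ b ^ 2) := (Real.sqrt_sq hδ0).symm
      _ ≤ M x := Real.sqrt_le_sqrt (single_le_sum (f := fun b => δ b ^ 2) (fun b _ => sq_nonneg (δ b)) hmem)
  -- the pointwise bound along the comb path, by induction on the signed depth
  have hpt : ∀ (n : ℕ) (x : Site P 0), ∑ μ : Fin P.d, (((x μ).val : ℤ) - ((rootOf k x μ).val : ℤ)).natAbs ≤ n → |ν x| ≤ n * M x := by
    intro n
    induction n with
    | zero =>
        intro x hx
        by_cases hr : rootOf k x = x
        · rw [eq_embIter_blockIter_of_rootOf_eq hr, hν0, abs_zero, Nat.cast_zero, zero_mul]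
        · obtain ⟨b, x', -, -, -, hdep⟩ := exists_nearEnd hk hr
          omega
    | succ n ih =>
        intro x hx
        by_cases hr : rootOf k x = x
        · rw [eq_embIter_blockIter_of_rootOf_eq hr, hν0, abs_zero]
          exact mul_nonneg (by positivity) (hM0 _)
        · obtain ⟨b, x', hb, hroot, hor, hdep⟩ := exists_nearEnd hk hr
          have hx' : ∑ μ : Fin P.d, (((x' μ).val : ℤ) - ((rootOf k x' μ).val : ℤ)).natAbs ≤ n := by omega
          have h1 := ih x' hx'
          rw [hMroot hroot] at h1
          have h2 := hδ b hb
          have hbM : δ b ≤ M x := by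
            refine hMge x b hb ?_
            rcases hor with ⟨hs, -⟩ | ⟨hs, -⟩
            · rw [hs, hroot]
            · rw [hs]
          have h3 : |ν x| ≤ |ν x'| + δ b := by
            rcases hor with ⟨hs, ht⟩ | ⟨hs, ht⟩
            · rw [hs, ht] at h2
              have := abs_sub_abs_le_abs_sub (ν x) (ν x')
              rw [abs_sub_comm] at h2
              linarith
            · rw [hs, ht] at h2
              have := abs_sub_abs_le_abs_sub (ν x) (ν x')
              linarith
          calc |ν x| ≤ |ν x'| + δ b := h3
            _ ≤ n * M x + M x := add_le_add h1 hbM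
            _ = ((n + 1 : ℕ) : ℝ) * M x := by push_cast; ring
  -- square and sum
  have hsq : ∀ x, ν x ^ 2 ≤ ((P.d * P.L ^ k : ℕ) : ℝ) ^ 2 * ∑ b ∈ CF.filter (fun b => rootOf k b.src = rootOf k x), δ b ^ 2 := by
    intro x
    have h1 := hpt (P.d * P.L ^ k) x (depth_le hk x)
    have h2 : |ν x| ≤ ((P.d * P.L ^ k : ℕ) : ℝ) * M x := h1
    rw [← hMsq, ← mul_pow, ← sq_abs (ν x)]
    exact pow_le_pow_left₀ (abs_nonneg _) h2 2
  have hswap : ∑ x : Site P 0, ∑ b ∈ CF.filter (fun b => rootOf k b.src = rootOf k x), δ b ^ 2 =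
      ((P.L ^ P.d) ^ k : ℕ) * ∑ b ∈ CF, δ b ^ 2 := by
    simp only [sum_filter]
    rw [sum_comm, mul_sum]
    refine sum_congr rfl fun b _ => ?_
    rw [← sum_filter, sum_const, card_filter_rootOf_eq hk b.src, nsmul_eq_mul]
  calc ∑ x, ν x ^ 2 ≤ ∑ x : Site P 0, ((P.d * P.L ^ k : ℕ) : ℝ) ^ 2 * ∑ b ∈ CF.filter (fun b => rootOf k b.src = rootOf k x), δ b ^ 2 :=
        sum_le_sum fun x _ => hsq x
    _ = ((P.d * P.L ^ k : ℕ) : ℝ) ^ 2 * (((P.L ^ P.d) ^ k : ℕ) * ∑ b ∈ CF, δ b ^ 2) := by rw [← mul_sum, hswap]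
    _ = (((P.d * P.L ^ k) ^ 2 * (P.L ^ P.d) ^ k : ℕ) : ℝ) * ∑ b ∈ CF, δ b ^ 2 := by push_cast; ring

/-! ## §3  The linear covariant form: the Faddeev–Popov coercivity -/

/-- ★★ **THE ROOTED POINCARÉ INEQUALITY, LINEAR COVARIANT FORM (the FP ∕ `D^*D` coercivity of (OPL))**: `E` any seminormed group (e.g. `𝔰𝔲(2)` in an
`Ad`-invariant norm, or matrices in the Frobenius ∕ operator norm), `T b : E → E` norm preserving for every bond (consumer: `T b := Ad(U₀ b)`), and
`λ : T_η → E` ROOTED (`λ = 0` at the `k`-centres — the Lie algebra of the residual gauge group near `1`).  Then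
`Σ_x ‖λ x‖² ≤ (d·Lᵏ)²·(Lᵈ)ᵏ · Σ_{b ∈ combSet k} ‖λ(b₋) − T_b λ(b₊)‖²`: the covariant differences on the COMB bonds alone control `λ`.
[cite: Balaban1985Variational, Thm 1 (10) p.279, (19) p.281, (142) p.299; Balaban1987RG1, (0.21) p.256] -/
theorem sum_norm_sq_le_comb_of_rooted (hk : k ≤ P.m + P.K) [DecidablePred (· ∈ (combSet k : Set (PBond P 0)))]
    {E : Type*} [SeminormedAddCommGroup E] (T : PBond P 0 → E → E) (hT : ∀ b v, ‖T b v‖ = ‖v‖)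
    (lam : Site P 0 → E) (hroot : ∀ y : Site P k, lam (embIter k y) = 0) :
    ∑ x, ‖lam x‖ ^ 2 ≤ (((P.d * P.L ^ k) ^ 2 * (P.L ^ P.d) ^ k : ℕ) : ℝ) *
      ∑ b ∈ univ.filter (fun b => b ∈ (combSet k : Set (PBond P 0))), ‖lam b.src - T b (lam b.tgt)‖ ^ 2 := by
  refine sum_sq_le_comb hk (fun x => ‖lam x‖) (fun b => ‖lam b.src - T b (lam b.tgt)‖) (fun y => by rw [hroot, norm_zero]) ?_
  intro b _
  rw [← hT b (lam b.tgt)]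
  exact abs_norm_sub_norm_le _ _

/-- ★ **OFF-PIVOT FORM** (the token shape of (T2) ∕ ✓`…S2BetaFibreGrowth`: the sum over the bonds that are NOT pivots `βₖ(c)`; comb bonds are not pivots,
✓`iterCentralBond_not_mem_combSet`): `Σ_x ‖λ x‖² ≤ C · Σ_{ℓ ∉ pivots} ‖λ(ℓ₋) − T_ℓ λ(ℓ₊)‖²` for rooted `λ`.  With the pivot rows of `D` (`D(λ,ξ)(βₖ c) = ξ_c`, no
`λ`) this is the coercivity `‖λ‖² + ‖ξ‖² ≤ max(C,1)·‖D(λ,ξ)‖²`. [cite: Balaban1985Variational, Thm 1 (10) p.279, (19) p.281; Balaban1987RG1, (0.4) p.253] -/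
theorem sum_norm_sq_le_offPivot_of_rooted (hk : k ≤ P.m + P.K)
    {E : Type*} [SeminormedAddCommGroup E] (T : PBond P 0 → E → E) (hT : ∀ b v, ‖T b v‖ = ‖v‖)
    (lam : Site P 0 → E) (hroot : ∀ y : Site P k, lam (embIter k y) = 0) :
    ∑ x, ‖lam x‖ ^ 2 ≤ (((P.d * P.L ^ k) ^ 2 * (P.L ^ P.d) ^ k : ℕ) : ℝ) *
      ∑ b ∈ univ.filter (fun ℓ : PBond P 0 => ∀ c, iterCentralBond (P := P) k c ≠ ℓ), ‖lam b.src - T b (lam b.tgt)‖ ^ 2 := by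
  classical
  refine (sum_norm_sq_le_comb_of_rooted hk T hT lam hroot).trans (mul_le_mul_of_nonneg_left ?_ (by positivity))
  refine sum_le_sum_of_subset_of_nonneg ?_ fun b _ _ => sq_nonneg _
  intro b hb
  rw [mem_filter] at hb ⊢
  exact ⟨mem_univ _, fun c hc => iterCentralBond_not_mem_combSet hk c (hc ▸ hb.2)⟩

/-- ★ **ALL-BONDS FORM**: `Σ_x ‖λ x‖² ≤ C · Σ_b ‖λ(b₋) − T_b λ(b₊)‖²` for rooted `λ` (the full covariant Dirichlet form dominates the comb part).
[cite: Balaban1985Variational, (142) p.299; Balaban1987RG1, (0.21) p.256] -/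
theorem sum_norm_sq_le_of_rooted (hk : k ≤ P.m + P.K)
    {E : Type*} [SeminormedAddCommGroup E] (T : PBond P 0 → E → E) (hT : ∀ b v, ‖T b v‖ = ‖v‖)
    (lam : Site P 0 → E) (hroot : ∀ y : Site P k, lam (embIter k y) = 0) :
    ∑ x, ‖lam x‖ ^ 2 ≤ (((P.d * P.L ^ k) ^ 2 * (P.L ^ P.d) ^ k : ℕ) : ℝ) * ∑ b, ‖lam b.src - T b (lam b.tgt)‖ ^ 2 := by
  classical
  refine (sum_norm_sq_le_comb_of_rooted hk T hT lam hroot).trans (mul_le_mul_of_nonneg_left ?_ (by positivity))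
  exact sum_le_sum_of_subset_of_nonneg (filter_subset _ _) fun b _ _ => sq_nonneg _

/-! ## §4  The group form: quantitative off-pivot freeness -/

/-- ★ **QUANTITATIVE OFF-PIVOT FREENESS** (group edition of ✓`eq_one_of_isResidual_of_gaugeAct_eq_on_combSet`): a gauge transformation `w` trivial at the
`k`-centres (print's rooted sheet `IsResidual k w`) that moves a configuration `U` little ON THE COMB BONDS is close to `1` everywhere:
`Σ_x dist1(w x)² ≤ (d·Lᵏ)²·(Lᵈ)ᵏ · Σ_{b ∈ combSet k} dist1((w • U) b · (U b)⁻¹)²` — any `GaugeGroup G`, any `U`, no smallness.  (One step: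
`w(b₋) = [(w•U)(b)·U(b)⁻¹] · U(b) w(b₊) U(b)⁻¹`, `dist1` subadditive and conjugation invariant.)
[cite: Balaban1985Variational, (181) p.307, (19) p.281; Balaban1985Averaging, (8), (19) pp.19-21] -/
theorem sum_dist1_sq_le_comb_of_rootTrivial (hk : k ≤ P.m + P.K) [DecidablePred (· ∈ (combSet k : Set (PBond P 0)))]
    {G : Type*} [GaugeGroup G] (w : GaugeTransf P 0 G) (hw : ∀ y : Site P k, w (embIter k y) = 1) (U : GaugeField P 0 G) :
    ∑ x, GaugeGroup.dist1 (w x) ^ 2 ≤ (((P.d * P.L ^ k) ^ 2 * (P.L ^ P.d) ^ k : ℕ) : ℝ) *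
      ∑ b ∈ univ.filter (fun b => b ∈ (combSet k : Set (PBond P 0))), GaugeGroup.dist1 (gaugeAct w U b * (U b)⁻¹) ^ 2 := by
  refine sum_sq_le_comb hk (fun x => GaugeGroup.dist1 (w x)) (fun b => GaugeGroup.dist1 (gaugeAct w U b * (U b)⁻¹))
    (fun y => by rw [hw, GaugeGroup.dist1_one]) ?_
  intro b _
  -- `g := (w•U)(b) · U(b)⁻¹ = w₋ · (U w₊⁻¹ U⁻¹)`
  have hg : gaugeAct w U b * (U b)⁻¹ = w b.src * (U b * (w b.tgt)⁻¹ * (U b)⁻¹) := by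
    simp only [gaugeAct]; group
  have hconj : GaugeGroup.dist1 (U b * (w b.tgt)⁻¹ * (U b)⁻¹) = GaugeGroup.dist1 (w b.tgt) := by
    rw [GaugeGroup.dist1_conj, GaugeGroup.dist1_inv]
  rw [abs_sub_le_iff]
  constructor
  · -- `w₋ = g · (U w₊ U⁻¹)`
    have h1 : w b.src = (gaugeAct w U b * (U b)⁻¹) * (U b * w b.tgt * (U b)⁻¹) := by
      simp only [gaugeAct]; group
    have h2 := GaugeGroup.dist1_mul_le (gaugeAct w U b * (U b)⁻¹) (U b * w b.tgt * (U b)⁻¹)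
    rw [← h1, GaugeGroup.dist1_conj] at h2
    linarith
  · -- `U w₊ U⁻¹ = g⁻¹ · w₋`
    have h1 : U b * w b.tgt * (U b)⁻¹ = (gaugeAct w U b * (U b)⁻¹)⁻¹ * w b.src := by
      simp only [gaugeAct]; group
    have h2 := GaugeGroup.dist1_mul_le ((gaugeAct w U b * (U b)⁻¹)⁻¹) (w b.src)
    rw [← h1, GaugeGroup.dist1_conj, GaugeGroup.dist1_inv] at h2
    linarith

end Summit.QuantumFields.YangMills.Theorems.FluctuationComparisonRegPrIntLS2BetaCombPoincare
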